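import Literature.NumberTheory.LFunctions.BurnolZetaSystems
import Literature.NumberTheory.ConnesConsani2021.ArchimedeanSoninTrace
import HarnessLib

/-!
# Burnol 2001 (CRAS 333): the Sonine spaces `K_{a,b}`, the evaluators `Z^Λ_{w,k}` in `H_Λ`, and the
# subspace `W_Λ` attached to `ζ` (statements as printed)

LABEL (line 1): **RH-FREE** — typed statements of the PRINTED theorems of J.-F. Burnol, *Sur certains
espaces de Hilbert de fonctions entières, liés à la transformation de Fourier et aux fonctions L de
Dirichlet et de Riemann*, C. R. Acad. Sci. Paris Sér. I **333** (2001) 201–206 = arXiv:math/0105120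
[Burnol2001CRAS] (TeX of record `dbl/src/Burnol2001CRAS_arXivmath0105120.tex`, plain TeX with hard-coded
numbering; statement lines `TeX l.nnn` below; the held text `paper:arxiv-math_0105120` agrees).
Hilbert-space theorems ABOUT the multiset of non-trivial zeros of `ζ` (whatever it is): no hypothesis
and no conclusion on the location of the zeros. bears_on: LADDER-RH COLUMN 6 (DBR), B-C/B-P. WHAT THIS
IS NOT: not a route, not an RH criterion, no positivity condition at `E_ζ` (Conrey–Li guard); typing
which evaluators are perpendicular to which subspace does not move RH; nothing here bears on the truth
of RH.

## Dictionary (Note ↦ tree; nothing is re-declared)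

* `K = L²(]0,∞[, dt)` (§1, TeX l.296) ↦ the a.e.-EVEN classes of `L²(ℝ)`,
  `Literature.NumberTheory.LFunctions.evenL2` (Burnol 2004's own convention, `BurnolZetaSystems.lean`;
  Burnol's squared norm `∫₀^∞|f|²` is half the `L²(ℝ)` norm — immaterial for closures, orthogonality,
  linear independence, which is all that is stated here). The cosine transform
  `𝓕₊(f)(t) = 2∫₀^∞ cos(2πtu) f(u) du` (TeX l.298–300) is Mathlib's `L²` Fourier transform `𝓕` on even
  classes; the "euclidean" pairing `(φ, ψ] = ∫ φ ψ` (TeX l.297) is written out as `∫ φ ψ` over `(0,∞)`.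
* `K_{a,b}` = "`f` supported in `[a,∞)` with `𝓕₊(f)` supported in `[b,∞)`" (TeX l.311–313) ↦ EXACTLY
  Connes–Consani's Sonin space `Literature.NumberTheory.ConnesConsani2021.soninSpace a b` (even, zero
  a.e. on `[−a,a]`, `𝓕` zero a.e. on `[−b,b]`); `K_λ := K_{λ,λ}` is also Burnol 2004's
  `Literature.NumberTheory.LFunctions.sonineK λ` (open intervals; the same a.e.).
* left Mellin transform `f̂(s) = ∫₀^∞ f(t) t^{s−1} dt` (TeX l.301) ↦ Mathlib's `mellin f s`; for
  `f ∈ K_{a,b}` it converges absolutely on `Re s < 1/2` and has an ENTIRE continuation (Thm. 1.1) —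
  `HasEntireMellin f G`; the completed transform `M(f)(s) = π^{−s/2}Γ(s/2) f̂(s)` of §2 (TeX l.437–440),
  an ENTIRE function for `f ∈ H_Λ` (the poles of `Γ` cancel the trivial zeros), ↦ `IsCompletedMellin f M`
  (the entire function agreeing with `Γ_ℝ(s)·∫₀^∞ f t^{s−1}` on `Re s > 1/2`, where `f ∈ H_Λ ⊂ L²(0,Λ)`
  makes the integral absolutely convergent and `Γ_ℝ` has no pole).
* `γ₊(s) = 2(2π)^{−s} cos(πs/2) Γ(s)` (TeX l.303) ↦ `gammaPlus` (Mathlib's `Γ` is `0` at its poles, so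
  `gammaPlus` is faithful off `{0, −1, −2, …}`; `gammaPlus_mul_gammaPlus_one_sub` off `ℤ`).
* `I(f)(t) = f(1/t)/t`, `𝒢 = I𝓕₊I`, `H_Λ = L²((0,Λ)) ∩ 𝒢(L²((0,Λ)))` and "on a `H_Λ = I K_{λ,λ}` avec
  `λ = 1/Λ`" (§2, TeX l.410–418) ↦ `memHLambda` (the printed two vanishing conditions, the second one
  unfolded through `I`: `𝒢f = 0` on `t > Λ` iff `𝓕₊(If) = 0` on `(0, 1/Λ)`).
* the evaluators `Z^Λ_{w,k} ∈ H_Λ`, `(f, Z^Λ_{w,k}] = M(f)^{(k)}(w)` (Prop. 2.2, TeX l.463–466) ↦ the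
  defining predicate `IsEvaluatorZ Λ w k Z` (under `I` these are Burnol 2004's `Z^{1/Λ}_{w,k} ∈ K_{1/Λ}`,
  `Literature.NumberTheory.LFunctions.IsBurnolZ` — Burnol 2004 §4 quotes the present Thm. 2.3 for them).
* `𝒱_Λ` (smooth, support in `[1/Λ, Λ]`), `D = u (d²/du²) u`, `E(φ)(u) = Σ_{n≥1} φ(nu) − (∫₀^∞φ)/u`,
  `W_Λ` = closure of `{E(φ) : φ ∈ D(𝒱_Λ)}` (§3, TeX l.503–519) ↦ `MemVLambda`, `poissonE`,
  `memDVLambda` ("les fonctions de `𝒱_Λ` dans l'image de `D` sont exactement celles vérifiant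
  `φ̂(0) = φ̂(1) = 0`", TeX l.514–516, taken as the definition of `D(𝒱_Λ)`), `crasW`.
* non-trivial zeros `ρ`, multiplicity `m_ρ` ↦ `ZetaZeros.riemannZetaNontrivialZeros`,
  `riemannZetaZeroOrder` (as in `BurnolZetaSystems.lean`).

Typed: Thm. 1.1 (cited from de Branges [13]), Lemme 1.2, Lemme 1.3 (its closed-form clauses), Thm. 1.4,
Thm. 1.5 (in the printed functional form: `Burnol2001CRAS_thm1_5C`, over the COMPENSATED pairing
`IsXPairingFnC`/`xPairingR`; the first typing `Burnol2001CRAS_thm1_5` evaluated `γ₊` at its poles and is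
refuted as typed by `Burnol2001CRAS_thm1_5_false`, and the first repair `Burnol2001CRAS_thm1_5R` pinned
the compensated product `γ₊(v)f̂(1−v)` at EVERY `v ∉ {0,−2,−4,…}`, hence also at the odd negative
integers where Mathlib's `Γ(−1) = Γ(−3) = … = 0` makes `gammaPlus` vanish although `γ₊(−1) = −2π² ≠ 0`
in print — refuted as typed by `Burnol2001CRAS_thm1_5R_false`; both kept as settled negatives, not
statements of the Note), Prop. 2.1, Thm. 2.3, Thm. 3.1, Déf. 3.2 — all as named facts
`def … : Prop` (D-0014) over honest definitions; Prop. 2.2 IS Burnol 2004 Thm. 2.1 (ii)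
(`Literature.NumberTheory.LFunctions.Burnol2004b_thm2_1`, after `I`) and is cited, not restated. The
abridged-English Theorems 1–3 (TeX l.168–215) are Thms. 1.4, 2.1+2.2+2.3, 3.1 of the French text. NOT
here: eq. (1.1) (Mellin–Plancherel, "bien connu"), (1.2)–(1.3) (proof devices), the closing remarks on
Dirichlet `L(s,χ)` (TeX l.552–558, no statement), and the companion Note [Burnol2002CRAS] (Sonine
spaces: explicit `ℰ_λ`) which is the sibling module `BurnolSonineStructureFunction.lean`.

## References
* [Burnol2001CRAS] C. R. Acad. Sci. Paris Sér. I 333 (2001) 201–206, doi:10.1016/s0764-4442(01)02036-5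
  = arXiv:math/0105120 (TeX read).
* [Burnol2004b] J. Théor. Nombres Bordeaux 16 (2004) 65–94 (the journal version of §§2–3; tree
  `BurnolZetaSystems.lean`).
* [ConnesConsani2021] Def. 4.4 (Sonin space `S(α,β)`, tree `ArchimedeanSoninTrace.lean`).
-/

noncomputable section

open _root_.MeasureTheory _root_.Complex _root_.Set _root_.Filter
open scoped Real Topology FourierTransform ComplexConjugate
open Literature.NumberTheory.LFunctions (evenL2 sonineK riemannZetaZeroOrder)
open Literature.NumberTheory.ConnesConsani2021 (soninSpace)

namespace Literature.Analysis.DeBrangesSpaces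

namespace Burnol2001

/-! ## §1. The spaces `K_{a,b}` -/

/-- RH-FREE (definition). Burnol's **`γ₊(s) = 2(2π)^{−s} cos(πs/2) Γ(s)`**, the spectral multiplier of
`Γ₊ = 𝓕₊ I` (§1, TeX l.301–305): `γ₊(s)γ₊(1−s) = 1`. Faithful off the poles `0, −1, −2, …` of `Γ`
(Mathlib's `Γ` is `0` there). [cite: Burnol2001CRAS, §1 (TeX l.301–305)] -/
def gammaPlus (s : ℂ) : ℂ :=
  2 * (2 * π : ℂ) ^ (-s) * Complex.cos (π * s / 2) * Complex.Gamma s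

/-- RH-FREE (definition). **Entire continuation of the left Mellin transform**: `G` is entire and
agrees with `f̂(s) = ∫₀^∞ f(t) t^{s−1} dt` (Mathlib's `mellin f s`) on the half-plane `Re s < 1/2`, where
the integral converges absolutely for `f ∈ K_{a,b}` ("si `f` est presque partout nulle sur `]0,a]` alors
`∫ f(t)t^{s−1}dt` est analytique dans le demi-plan `Re(s) < 1/2`", TeX l.314–316). Such a `G` is unique.
[cite: Burnol2001CRAS, §1 (TeX l.314–318)] -/
def HasEntireMellin (f : ℝ → ℂ) (G : ℂ → ℂ) : Prop :=
  Differentiable ℂ G ∧ ∀ s : ℂ, s.re < 1 / 2 → G s = mellin f s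

/-- RH-FREE. **Théorème 1.1** (TeX l.320–321, "voir [13]" = de Branges, *Espaces Hilbertiens de
Fonctions Entières*), verbatim: *Toute fonction d'un espace `K_{a,b}` a une transformée de Mellin qui
est une fonction entière de `s ∈ ℂ`.* Typed: for `a, b > 0` and `f ∈ K_{a,b}` (= `soninSpace a b`),
the left Mellin transform of (a representative of) `f` has an entire continuation. For `a = b` this is,
after `I`, Burnol 2004 Thm. 2.1 (i) (`Literature.NumberTheory.LFunctions.Burnol2004b_thm2_1`).
[cite: Burnol2001CRAS, Théorème 1.1 (TeX l.320–321)] -/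
def Burnol2001CRAS_thm1_1 : Prop :=
  ∀ a b : ℝ, 0 < a → 0 < b → ∀ f : Lp ℂ 2 (volume : Measure ℝ), f ∈ soninSpace a b →
    ∃ G : ℂ → ℂ, HasEntireMellin f G

/-- RH-FREE (definition). **`C_a(u, w) = 2∫_a^∞ cos(2πut) t^{w−1} dt`** (TeX l.338), absolutely
convergent for `Re w < 0` (Bochner integral; junk where not integrable). Its entire continuation in `w`
(Lemme 1.2) is carried by `IsBurnolC`. [cite: Burnol2001CRAS, §1 (TeX l.338–345)] -/
def burnolC (a u : ℝ) (w : ℂ) : ℂ :=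
  2 * ∫ t in Ioi a, (Real.cos (2 * π * u * t) : ℂ) * (t : ℂ) ^ (w - 1)

/-- RH-FREE (definition). `G` is THE entire continuation of `w ↦ C_a(u, w)` from `Re w < 0`.
[cite: Burnol2001CRAS, Lemme 1.2 (TeX l.354–355)] -/
def IsBurnolC (a u : ℝ) (G : ℂ → ℂ) : Prop :=
  Differentiable ℂ G ∧ ∀ w : ℂ, w.re < 0 → G w = burnolC a u w

/-- RH-FREE. **Lemme 1.2** (TeX l.354–355), verbatim: *La fonction `C_a(u,w)` pour `u > 0` fixé est une
fonction entière de `w`.* Typed: for `a > 0`, `u > 0`, `w ↦ C_a(u, w)` (`Re w < 0`) has an entire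
continuation. [cite: Burnol2001CRAS, Lemme 1.2 (TeX l.354–355)] -/
def Burnol2001CRAS_lem1_2 : Prop :=
  ∀ a u : ℝ, 0 < a → 0 < u → ∃ G : ℂ → ℂ, IsBurnolC a u G

/-- RH-FREE. **Lemme 1.3**, the closed-form clauses (TeX l.358–367), verbatim: *Pour `Re(w) > 0`, elle
vaut `γ₊(w) u^{−w} − 2∫₀^a cos(2πut) t^{w−1} dt` […]. On a `C_a(u, 1+2j) = −𝓕₊(𝟙_{t≤a} t^{2j})(u)` pour
`j ∈ ℕ`.* Typed for the entire continuation `G` of `C_a(u, ·)` (`a, u > 0`): (i) the formula on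
`Re w > 0` (off the poles of `Γ`, where `gammaPlus` is faithful — `Re w > 0` contains none);
(ii) `G(1+2j) = −2∫₀^a cos(2πut) t^{2j} dt`. NOT typed here: the analyticity of `u ↦ C_a(u,w)` on
`ℂ ∖ ]−∞,0]`, "entire in `u` iff `w ∈ {±(1+2j)}`", the uniform `O(1/u)` bound on `[1,∞)`, and the
`K`-membership criterion "`Re w < 1/2` or `w ∈ {1,3,5,…}`" (TeX l.358–366) — TODO(general form).
[cite: Burnol2001CRAS, Lemme 1.3 (TeX l.358–367)] -/
def Burnol2001CRAS_lem1_3 : Prop :=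
  ∀ a u : ℝ, 0 < a → 0 < u → ∀ G : ℂ → ℂ, IsBurnolC a u G →
    (∀ w : ℂ, 0 < w.re →
      G w = gammaPlus w * (u : ℂ) ^ (-w) -
        2 * ∫ t in Ioc 0 a, (Real.cos (2 * π * u * t) : ℂ) * (t : ℂ) ^ (w - 1)) ∧
    (∀ j : ℕ, G (1 + 2 * j) = -(2 * ∫ t in Ioc 0 a, (Real.cos (2 * π * u * t) : ℂ) * (t : ℂ) ^ (2 * j)))

/-- RH-FREE. **Théorème 1.4** (TeX l.369–372; = Theorem 1 of the English summary, TeX l.168–171),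
verbatim: *Soient `a > 0`, `b > 0` fixés. Les transformées de Mellin `f̂(s)` des fonctions `f ∈ K_{a,b}`
possèdent en `1, 3, 5, …` des zéros triviaux et ce sont leurs seuls zéros communs.* Typed over the
entire continuations (`HasEntireMellin`): (i) every `f̂` vanishes at `1 + 2j`; (ii) a complex `w` at
which `f̂(w) = 0` for EVERY `f ∈ K_{a,b}` is one of `1 + 2j`. ("Simple as common zeros", TeX l.170 and
l.391–392, is not restated.) [cite: Burnol2001CRAS, Théorème 1.4 (TeX l.369–372)] -/
def Burnol2001CRAS_thm1_4 : Prop :=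
  ∀ a b : ℝ, 0 < a → 0 < b →
    (∀ f : Lp ℂ 2 (volume : Measure ℝ), f ∈ soninSpace a b → ∀ G : ℂ → ℂ, HasEntireMellin f G →
      ∀ j : ℕ, G (1 + 2 * j) = 0) ∧
    (∀ w : ℂ, (∀ f : Lp ℂ 2 (volume : Measure ℝ), f ∈ soninSpace a b → ∀ G : ℂ → ℂ,
        HasEntireMellin f G → G w = 0) → ∃ j : ℕ, w = 1 + 2 * j)

/-- RH-FREE (definition). **The pairing functionals of the vectors `X^λ_{w,k}`** (TeX l.393–402): "pour
tout `f ∈ K_{λ,λ}` on a pour `Re(w) > 1/2` `(f, X^λ_{w,k}] = (d^k/dw^k) f̂(1−w)` et pour `Re(w) ≤ 1/2`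
`(f, X^λ_{w,k}] = (d^k/dw^k)(γ₊(w) f̂(1−w))`" — the value of the `k`-th `w`-derivative at `w`, for the
entire continuation `G` of `f̂`. [cite: Burnol2001CRAS, §1 (TeX l.393–402)] -/
def xPairing (G : ℂ → ℂ) (w : ℂ) (k : ℕ) : ℂ :=
  if 1 / 2 < w.re then iteratedDeriv k (fun v => G (1 - v)) w
  else iteratedDeriv k (fun v => gammaPlus v * G (1 - v)) w

/-- RH-FREE. **Théorème 1.5** (TeX l.406–408), verbatim: *Soit `λ > 0`. Les projections orthogonales des
vecteurs `X^λ_{w,k}` sur `K_{λ,λ}` sont linéairement indépendantes.* Lean rendering (equivalent, via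
the printed pairing identities TeX l.398–402: a finite combination of the projections vanishes iff the
corresponding combination of the functionals `f ↦ (f, X^λ_{w,k}]` vanishes on `K_{λ,λ}`, the space being
stable under complex conjugation): the functionals `f ↦ (f, X^λ_{w,k}]`, `(w,k) ∈ ℂ × ℕ`, restricted to
`K_{λ,λ}`, are linearly independent — for every finite family of distinct indices and coefficients, if
`Σ c_i (f, X^λ_{w_i,k_i}] = 0` for all `f ∈ K_{λ,λ}` then all `c_i = 0`.
**REFUTABLE AS TYPED** (junk value, NOT a defect of the print): `xPairing` evaluates the pointwise
product `γ₊(v)·G(1 − v)` AT the poles `v ∈ {0, −2, −4, …}` of `γ₊`, where Mathlib's `Γ` is `0`, so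
`xPairing G 0 0 = 0` for every `G` and the family `{(0,0)}` refutes the statement
(`Burnol2001CRAS_thm1_5_false` below; dbl-ref tier-1 verdict on p422506). The print means the
COMPENSATED analytic product ("On notera en particulier la compensation entre les pôles de `γ₊(w)` et
les zéros triviaux de `f̂(1−w)`", TeX l.402–403); the faithful statement is `Burnol2001CRAS_thm1_5R`.
[cite: Burnol2001CRAS, Théorème 1.5 (TeX l.406–408)] -/
def Burnol2001CRAS_thm1_5 : Prop :=
  ∀ lam : ℝ, 0 < lam → ∀ (s : Finset (ℂ × ℕ)) (c : ℂ × ℕ → ℂ),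
    (∀ f : Lp ℂ 2 (volume : Measure ℝ), f ∈ soninSpace lam lam → ∀ G : ℂ → ℂ,
      HasEntireMellin f G →
      ∑ p ∈ s, c p * xPairing G p.1 p.2 = 0) →
    ∀ p ∈ s, c p = 0

/-- RH-FREE (definition). **The compensated pairing function** of the branch `Re w ≤ 1/2` (TeX
l.398–403: "`(f, X^λ_{w,k}] = (d^k/dw^k)(γ₊(w) f̂(1−w))` … On notera en particulier la compensation
entre les pôles de `γ₊(w)` et les zéros triviaux de `f̂(1−w)`"): `P` is THE entire function agreeing
with `v ↦ γ₊(v) G(1 − v)` off the poles `v ∈ {0, −2, −4, …}` of `γ₊` (`G` = the entire continuation of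
`f̂`). For `f ∈ K_{λ,λ}` the poles of `γ₊` at `v = −2j` are simple and `f̂(1 − v) = f̂(1 + 2j) = 0`
there (Théorème 1.4), so the singularities are removable and such a `P` exists; it is unique by the
identity theorem. **DEFECTIVE AS TYPED** (junk value, NOT a defect of the print): the condition is also
imposed at `v = −1, −3, −5, …`, where Mathlib's `Γ(v) = 0` gives `gammaPlus v = 0` whereas the printed
`γ₊` is finite and NON-ZERO there (`γ₊(−1) = −2π²`: the zero of `cos(πv/2)` cancels the pole of `Γ`);
so it forces `P(−1) = 0`, and for `f ∈ K_{λ,λ}` no such `P` exists unless `f̂(2) = f̂(4) = … = 0`. The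
faithful predicate is `IsXPairingFnC` (agreement on the junk-free half-plane `Re v > 0`).
[cite: Burnol2001CRAS, §1 (TeX l.398–403)] -/
def IsXPairingFn (G P : ℂ → ℂ) : Prop :=
  Differentiable ℂ P ∧ ∀ v : ℂ, (∀ n : ℕ, v ≠ -(2 * (n : ℂ))) → P v = gammaPlus v * G (1 - v)

/-- RH-FREE (definition). **The pairing functionals `f ↦ (f, X^λ_{w,k}]`, compensated form** (TeX
l.398–403): for `Re w > 1/2` the `k`-th `w`-derivative of `f̂(1 − w)`, for `Re w ≤ 1/2` the `k`-th
derivative at `w` of the compensated analytic product `P` (`IsXPairingFn G P`). Replaces `xPairing`,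
whose `Re w ≤ 1/2` branch carries junk at the poles of `γ₊`. [cite: Burnol2001CRAS, §1 (TeX l.398–403)] -/
def xPairingR (G P : ℂ → ℂ) (w : ℂ) (k : ℕ) : ℂ :=
  if 1 / 2 < w.re then iteratedDeriv k (fun v => G (1 - v)) w else iteratedDeriv k P w

/-- RH-FREE. **Théorème 1.5, repaired statement** (TeX l.406–408), verbatim: *Soit `λ > 0`. Les
projections orthogonales des vecteurs `X^λ_{w,k}` sur `K_{λ,λ}` sont linéairement indépendantes.*
Rendering as for `Burnol2001CRAS_thm1_5` (the functionals `f ↦ (f, X^λ_{w,k}]` restricted to `K_{λ,λ}`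
are linearly independent), but with the printed COMPENSATED pairing: for `f ∈ K_{λ,λ}` with entire
Mellin continuation `G` and compensated pairing function `P` (`IsXPairingFn G P`), if
`Σ c_i (f, X^λ_{w_i,k_i}] = 0` for all such `f` then all `c_i = 0`.
**REFUTABLE AS TYPED** (junk value, NOT a defect of the print): `IsXPairingFn G P` forces
`P(−1) = gammaPlus(−1)·G(2) = 0` (Mathlib's `Γ(−1) = 0`), so `xPairingR G P (−1) 0 = 0` for every
admissible `(G, P)` and the family `{(−1, 0)}` refutes the statement (`Burnol2001CRAS_thm1_5R_false`
below). The faithful statement is `Burnol2001CRAS_thm1_5C`.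
[cite: Burnol2001CRAS, Théorème 1.5 (TeX l.406–408)] -/
def Burnol2001CRAS_thm1_5R : Prop :=
  ∀ lam : ℝ, 0 < lam → ∀ (s : Finset (ℂ × ℕ)) (c : ℂ × ℕ → ℂ),
    (∀ f : Lp ℂ 2 (volume : Measure ℝ), f ∈ soninSpace lam lam → ∀ G P : ℂ → ℂ,
      HasEntireMellin f G → IsXPairingFn G P →
      ∑ p ∈ s, c p * xPairingR G P p.1 p.2 = 0) →
    ∀ p ∈ s, c p = 0

/-- RH-FREE (definition). **The compensated pairing function, faithful form** (TeX l.398–403: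
"`(f, X^λ_{w,k}] = (d^k/dw^k)(γ₊(w) f̂(1−w))` … On notera en particulier la compensation entre les pôles
de `γ₊(w)` et les zéros triviaux de `f̂(1−w)`"): `P` is THE entire function agreeing with
`v ↦ γ₊(v) G(1 − v)` on the open half-plane `Re v > 0`, where Mathlib's `Γ` — hence `gammaPlus` — has
neither poles nor junk zeros (`G` = the entire continuation of `f̂`). Unique by the identity theorem,
and equal to the printed compensated analytic product wherever the latter is defined. For `f ∈ K_{λ,λ}`
such a `P` exists: it is the entire Mellin continuation of `𝓕₊f` (eq. (1.1), TeX l.279–281: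
`f̂(s) = γ₊(s)·(𝓕₊f)^(1−s)`, applied to `𝓕₊f ∈ K_{λ,λ}`). [cite: Burnol2001CRAS, §1 (TeX l.398–403)] -/
def IsXPairingFnC (G P : ℂ → ℂ) : Prop :=
  Differentiable ℂ P ∧ ∀ v : ℂ, 0 < v.re → P v = gammaPlus v * G (1 - v)

/-- RH-FREE. **Théorème 1.5, faithful statement** (TeX l.406–408), verbatim: *Soit `λ > 0`. Les
projections orthogonales des vecteurs `X^λ_{w,k}` sur `K_{λ,λ}` sont linéairement indépendantes.*
Rendering as for `Burnol2001CRAS_thm1_5R` (the functionals `f ↦ (f, X^λ_{w,k}]`, `(w,k) ∈ ℂ × ℕ`,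
restricted to `K_{λ,λ}`, are linearly independent: `(f, X^λ_{w,k}] = (d^k/dw^k) f̂(1−w)` for
`Re w > 1/2` and `= P^{(k)}(w)` for `Re w ≤ 1/2`, `P` the compensated product), with the compensated
pairing function pinned on the junk-free half-plane (`IsXPairingFnC`). For every `f ∈ K_{λ,λ}` the
functions `G` (Théorème 1.1) and `P` (eq. (1.1)) exist, so the hypothesis is not vacuous.
[cite: Burnol2001CRAS, Théorème 1.5 (TeX l.406–408)] -/
def Burnol2001CRAS_thm1_5C : Prop :=
  ∀ lam : ℝ, 0 < lam → ∀ (s : Finset (ℂ × ℕ)) (c : ℂ × ℕ → ℂ),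
    (∀ f : Lp ℂ 2 (volume : Measure ℝ), f ∈ soninSpace lam lam → ∀ G P : ℂ → ℂ,
      HasEntireMellin f G → IsXPairingFnC G P →
      ∑ p ∈ s, c p * xPairingR G P p.1 p.2 = 0) →
    ∀ p ∈ s, c p = 0

/-! ## §2. The spaces `H_Λ` and the vectors `Z^Λ_{w,k}` -/

/-- RH-FREE (definition). Membership in **`H_Λ = L²((0,Λ)) ∩ 𝒢(L²((0,Λ)))`**, `𝒢 = I𝓕₊I`,
`I(f)(t) = f(1/t)/t` (§2, TeX l.410–418: "l'espace des fonctions dans `K` presque partout nulles pour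
`t > Λ` et dont les images sous `𝒢 := I𝓕₊I` sont presque partout nulles pour `t > Λ`. On a
`H_Λ = I K_{λ,λ}` avec `λ = 1/Λ`"): an even class `f`, a.e. zero on `|t| > Λ`, whose image `If` (as an
`L²` class `g`, `g(t) = f(1/t)/|t|` a.e. — `I` is unitary on `K`) has cosine transform a.e. zero on
`|t| < 1/Λ` (which is `𝒢f = 0` for `|t| > Λ`, unfolded). [cite: Burnol2001CRAS, §2 (TeX l.410–418)] -/
def memHLambda (Λ : ℝ) (f : Lp ℂ 2 (volume : Measure ℝ)) : Prop :=
  f ∈ evenL2 ∧ (∀ᵐ t : ℝ, Λ < |t| → f t = 0) ∧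
    ∃ g : Lp ℂ 2 (volume : Measure ℝ), (∀ᵐ t : ℝ, g t = f (t⁻¹) / ((|t| : ℝ) : ℂ)) ∧
      ∀ᵐ t : ℝ, |t| < Λ⁻¹ → (𝓕 g : Lp ℂ 2 (volume : Measure ℝ)) t = 0

/-- RH-FREE. **Proposition 2.1** (TeX l.427–428), verbatim: *On a `⋂ H_Λ = {0}` et
`closure (⋃ H_Λ) = K`.* [cite: Burnol2001CRAS, Proposition 2.1 (TeX l.427–428)] -/
def Burnol2001CRAS_prop2_1 : Prop :=
  (∀ f : Lp ℂ 2 (volume : Measure ℝ), (∀ Λ : ℝ, 0 < Λ → memHLambda Λ f) → f = 0) ∧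
    evenL2 ⊆ closure {f : Lp ℂ 2 (volume : Measure ℝ) | ∃ Λ : ℝ, 0 < Λ ∧ memHLambda Λ f}

/-- RH-FREE (definition). **The completed Mellin transform `M(f)(s) = π^{−s/2}Γ(s/2) f̂(s)` of
`f ∈ H_Λ` as an ENTIRE function** (TeX l.437–440: "on associe à `f ∈ H_Λ` … la fonction entière
`M(f)(s)`"): `M` is entire and agrees with `Γ_ℝ(s) · ∫₀^∞ f(t) t^{s−1} dt` on `Re s > 1/2`, where for
`f ∈ H_Λ ⊂ L²((0,Λ))` the integral converges absolutely and `Γ_ℝ` has no pole (so the trivial zeros of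
`f̂` at `0, −2, …` are correctly absorbed). Unique when it exists. [cite: Burnol2001CRAS, §2 (TeX l.437–441)] -/
def IsCompletedMellin (f : ℝ → ℂ) (M : ℂ → ℂ) : Prop :=
  Differentiable ℂ M ∧ ∀ s : ℂ, 1 / 2 < s.re → M s = Gammaℝ s * mellin f s

/-- RH-FREE (definition). **`Z` IS the evaluator `Z^Λ_{w,k}`** (TeX l.463–466: "il existe donc un unique
vecteur `Z^Λ_{w,k}` dans `H_Λ` tel que `∀ f ∈ H_Λ, M(f)^{(k)}(w) = (f, Z^Λ_{w,k}]`", euclidean pairing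
`∫₀^∞ f Z`). Under `I` this is Burnol 2004's `Z^{1/Λ}_{w,k} ∈ K_{1/Λ}`
(`Literature.NumberTheory.LFunctions.IsBurnolZ`). [cite: Burnol2001CRAS, Proposition 2.2 (TeX l.463–466)] -/
def IsEvaluatorZ (Λ : ℝ) (w : ℂ) (k : ℕ) (Z : Lp ℂ 2 (volume : Measure ℝ)) : Prop :=
  memHLambda Λ Z ∧ ∀ f : Lp ℂ 2 (volume : Measure ℝ), memHLambda Λ f → ∀ M : ℂ → ℂ,
    IsCompletedMellin f M → ∫ t in Ioi (0 : ℝ), f t * Z t = iteratedDeriv k M w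

/-- RH-FREE. **Théorème 2.3** (TeX l.475–477; quoted as such by Burnol 2004, proof of Prop. 4.2),
verbatim: *Les vecteurs `Z^Λ_{w,k}` pour `w ∈ ℂ`, `k ∈ ℕ` sont linéairement indépendants (en
particulier ils sont tous non nuls).* Typed: for `Λ > 0`, any assignment of evaluators
`(w,k) ↦ Z^Λ_{w,k}` (each satisfying `IsEvaluatorZ`) is a linearly independent family.
[cite: Burnol2001CRAS, Théorème 2.3 (TeX l.475–477)] -/
def Burnol2001CRAS_thm2_3 : Prop :=
  ∀ Λ : ℝ, 0 < Λ → ∀ Z : ℂ × ℕ → Lp ℂ 2 (volume : Measure ℝ),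
    (∀ p : ℂ × ℕ, IsEvaluatorZ Λ p.1 p.2 (Z p)) → LinearIndependent ℂ Z

/-! ## §3. The spaces `W_Λ` and `HP_Λ` for `Λ > 1` -/

/-- RH-FREE (definition). Membership in **`𝒱_Λ`**: "l'espace vectoriel des fonctions infiniment
différentiables et supportées par `[1/Λ, Λ]`" (TeX l.503–505), as functions on `ℝ` (values off
`(0,∞)` irrelevant: support inside `[1/Λ, Λ]`). [cite: Burnol2001CRAS, §3 (TeX l.503–505)] -/
def MemVLambda (Λ : ℝ) (φ : ℝ → ℂ) : Prop :=
  ContDiff ℝ (⊤ : ℕ∞) φ ∧ Function.support φ ⊆ Icc Λ⁻¹ Λ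

/-- RH-FREE (definition). Membership in **`D(𝒱_Λ)`**, `D = u (d²/du²) u`: "les fonctions de `𝒱_Λ` dans
l'image de `D` sont exactement celles vérifiant `φ̂(0) = φ̂(1) = 0`" (TeX l.512–516), i.e.
`∫₀^∞ φ(t) t⁻¹ dt = 0` and `∫₀^∞ φ(t) dt = 0` — taken as the definition.
[cite: Burnol2001CRAS, §3 (TeX l.512–516)] -/
def MemDVLambda (Λ : ℝ) (φ : ℝ → ℂ) : Prop :=
  MemVLambda Λ φ ∧ (∫ t in Ioi (0 : ℝ), φ t / (t : ℂ)) = 0 ∧ (∫ t in Ioi (0 : ℝ), φ t) = 0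

/-- RH-FREE (definition). **`E(φ)(u) = Σ_{n ≥ 1} φ(nu) − (∫₀^∞ φ(t)dt)/u`** (TeX l.509–511; a finite
sum for compactly supported `φ`), written for `u > 0` and extended evenly (`|u|`) to match the even
realisation of `K`. [cite: Burnol2001CRAS, §3 (TeX l.509–511)] -/
def poissonE (φ : ℝ → ℂ) (u : ℝ) : ℂ :=
  (∑' n : ℕ, φ (((n : ℝ) + 1) * |u|)) - (∫ t in Ioi (0 : ℝ), φ t) / ((|u| : ℝ) : ℂ)

/-- RH-FREE (definition). **`W_Λ`** = "l'adhérence dans `K` des fonctions `E(φ)` pour `φ ∈ D(𝒱_Λ)`"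
(TeX l.517–519): the closure in `L²(ℝ)` of the set of classes a.e. equal to some `E(φ)`,
`φ ∈ D(𝒱_Λ)`. [cite: Burnol2001CRAS, §3 (TeX l.517–519)] -/
def crasW (Λ : ℝ) : Set (Lp ℂ 2 (volume : Measure ℝ)) :=
  closure {F | ∃ φ : ℝ → ℂ, MemDVLambda Λ φ ∧ ∀ᵐ u : ℝ, F u = poissonE φ u}

/-- RH-FREE. **Théorème 3.1** (TeX l.522–526; = Theorem 3 of the English summary), verbatim: *Soit
`Λ > 1`. On a `W_Λ ⊂ H_Λ`. Un vecteur `Z^Λ_{w,k}` est perpendiculaire à `W_Λ` si et seulement si `w` est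
un zéro non-trivial `ρ` de la fonction dzêta de Riemann et `0 ≤ k < m_ρ` (`m_ρ` = multiplicité de
`ρ`).* Perpendicularity is in the Hilbert space `K` (`⟪·,·⟫` of `L²`).
[cite: Burnol2001CRAS, Théorème 3.1 (TeX l.522–526)] -/
def Burnol2001CRAS_thm3_1 : Prop :=
  ∀ Λ : ℝ, 1 < Λ →
    (∀ F : Lp ℂ 2 (volume : Measure ℝ), F ∈ crasW Λ → memHLambda Λ F) ∧
    (∀ (w : ℂ) (k : ℕ) (Z : Lp ℂ 2 (volume : Measure ℝ)), IsEvaluatorZ Λ w k Z →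
      ((∀ F : Lp ℂ 2 (volume : Measure ℝ), F ∈ crasW Λ → inner ℂ F Z = 0) ↔
        (w ∈ Literature.NumberTheory.LFunctions.ZetaZeros.riemannZetaNontrivialZeros ∧
          (k : ℤ) < riemannZetaZeroOrder w)))

/-- RH-FREE (definition). **Définition 3.2** (TeX l.543–544), verbatim: *Soit `Λ > 1`. On désigne par
`HP_Λ` le complément orthogonal de `W_Λ` dans `H_Λ`* — so that
`K = (L²((Λ,∞)) + 𝒢L²((Λ,∞))) ⊥ W_Λ ⊥ HP_Λ` (TeX l.547–548). [cite: Burnol2001CRAS, Définition 3.2 (TeX l.543–544)] -/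
def crasHP (Λ : ℝ) : Set (Lp ℂ 2 (volume : Measure ℝ)) :=
  {f | memHLambda Λ f ∧ ∀ F : Lp ℂ 2 (volume : Measure ℝ), F ∈ crasW Λ → inner ℂ F f = 0}

/-! ## Two elementary identities recorded with proofs -/

/-- `γ₊(s) γ₊(1 − s) = 1` off the integers (TeX l.303–304: "On a donc `γ₊(s)γ₊(1−s) = 1`"), from the
reflection formula `Γ(s)Γ(1−s) = π / sin(πs)`. [cite: Burnol2001CRAS, §1 (TeX l.303–304)] -/
theorem gammaPlus_mul_gammaPlus_one_sub {s : ℂ} (hs : ∀ n : ℤ, s ≠ n) :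
    gammaPlus s * gammaPlus (1 - s) = 1 := by
  have hsin : Complex.sin (π * s) ≠ 0 := by
    rw [Complex.sin_ne_zero_iff]
    intro n h
    apply hs n
    have hπ : (π : ℂ) ≠ 0 := by exact_mod_cast Real.pi_ne_zero
    have : (n : ℂ) * π = s * π := by rw [mul_comm s]; exact h.symm ▸ rfl
    exact (mul_right_cancel₀ hπ this).symm
  have hG : Complex.Gamma s * Complex.Gamma (1 - s) = π / Complex.sin (π * s) :=
    Complex.Gamma_mul_Gamma_one_sub s
  have hcos : Complex.cos (π * (1 - s) / 2) = Complex.sin (π * s / 2) := by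
    rw [show (π : ℂ) * (1 - s) / 2 = π / 2 - π * s / 2 by ring, Complex.cos_pi_div_two_sub]
  have h2π : (2 * π : ℂ) ≠ 0 := by
    have : (π : ℂ) ≠ 0 := by exact_mod_cast Real.pi_ne_zero
    exact mul_ne_zero two_ne_zero this
  have hpow : (2 * π : ℂ) ^ (-s) * (2 * π : ℂ) ^ (-(1 - s)) = (2 * π : ℂ)⁻¹ := by
    rw [← Complex.cpow_add _ _ h2π, show -s + -(1 - s) = (-1 : ℂ) by ring, Complex.cpow_neg_one]
  have hdouble : Complex.sin (π * s) = 2 * Complex.sin (π * s / 2) * Complex.cos (π * s / 2) := by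
    rw [← Complex.sin_two_mul]; ring_nf
  unfold gammaPlus
  rw [hcos]
  calc 2 * (2 * π : ℂ) ^ (-s) * Complex.cos (π * s / 2) * Complex.Gamma s *
        (2 * (2 * π : ℂ) ^ (-(1 - s)) * Complex.sin (π * s / 2) * Complex.Gamma (1 - s))
      = 4 * ((2 * π : ℂ) ^ (-s) * (2 * π : ℂ) ^ (-(1 - s))) *
          (Complex.sin (π * s / 2) * Complex.cos (π * s / 2)) *
          (Complex.Gamma s * Complex.Gamma (1 - s)) := by ring
    _ = 4 * (2 * π : ℂ)⁻¹ * (Complex.sin (π * s / 2) * Complex.cos (π * s / 2)) *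
          (π / Complex.sin (π * s)) := by rw [hpow, hG]
    _ = 1 := by
        rw [hdouble]
        have hπ : (π : ℂ) ≠ 0 := by exact_mod_cast Real.pi_ne_zero
        have hsc : Complex.sin (π * s / 2) * Complex.cos (π * s / 2) ≠ 0 := by
          intro h0
          apply hsin
          rw [hdouble, mul_assoc, h0, mul_zero]
        have hs2 : Complex.sin (π * s / 2) ≠ 0 := fun h => hsc (by rw [h, zero_mul])
        have hc2 : Complex.cos (π * s / 2) ≠ 0 := fun h => hsc (by rw [h, mul_zero])
        field_simp
        ring

/-- For a compactly supported `φ` (support in `[1/Λ, Λ]`, `Λ > 0`) and `u > 0` the sum in `E(φ)(u)` is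
finite: `φ(nu) = 0` once `n > Λ/u`. Recorded as: the family `n ↦ φ((n+1)u)` has finite support, hence
is summable. [cite: Burnol2001CRAS, §3 (TeX l.509–511)] -/
theorem summable_poissonE_terms {Λ : ℝ} {φ : ℝ → ℂ} (hφ : Function.support φ ⊆ Icc Λ⁻¹ Λ)
    {u : ℝ} (hu : 0 < u) : Summable (fun n : ℕ => φ (((n : ℝ) + 1) * |u|)) := by
  refine summable_of_hasFiniteSupport ?_
  show (Function.support _).Finite
  apply (Set.finite_Iio ⌈Λ / u⌉₊).subset
  intro n hn
  rw [Function.mem_support] at hn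
  have hmem : ((n : ℝ) + 1) * |u| ∈ Icc Λ⁻¹ Λ := hφ (Function.mem_support.mpr hn)
  rw [abs_of_pos hu] at hmem
  simp only [mem_Iio]
  by_contra hge
  push Not at hge
  have h1 : (⌈Λ / u⌉₊ : ℝ) ≤ n := by exact_mod_cast hge
  have h2 : Λ / u ≤ n := (Nat.le_ceil _).trans h1
  have h3 : Λ ≤ n * u := by rwa [div_le_iff₀ hu] at h2
  have h4 : ((n : ℝ) + 1) * u ≤ Λ := hmem.2
  nlinarith

/-! ## The junk value in `xPairing`: `Burnol2001CRAS_thm1_5` is refutable as typed -/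

/-- `γ₊(0) = 0` in Lean: Mathlib's `Γ(0) = 0` (a pole in print). [folklore] -/
private theorem gammaPlus_zero : gammaPlus 0 = 0 := by
  simp [gammaPlus, Complex.Gamma_zero]

/-- At `w = 0`, `k = 0` the uncompensated pairing is the junk value `γ₊(0)·G(1) = 0` for EVERY `G`.
[folklore] -/
private theorem xPairing_zero_zero (G : ℂ → ℂ) : xPairing G 0 0 = 0 := by
  simp [xPairing, gammaPlus_zero]

/-- **`Burnol2001CRAS_thm1_5` is FALSE as typed** (the kernel negative recorded by the cell referee,
dbl-ref tier-1 verdict on p422506): with `λ = 1`, the singleton family `{(0, 0)}` and `c ≡ 1`, the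
hypothesis `∑ c_p (f, X_p] = 0` holds for every `f` and `G` because `xPairing G 0 0 = γ₊(0) G(1) = 0`
(Mathlib's `Γ(0) = 0`), while `c (0,0) = 1 ≠ 0`. This refutes the TYPING (evaluation of the pointwise
product at a pole of `γ₊`), not the printed theorem, whose compensated form is
`Burnol2001CRAS_thm1_5R`. [cite: Burnol2001CRAS, Théorème 1.5 (TeX l.406–408)] -/
theorem Burnol2001CRAS_thm1_5_false : ¬ Burnol2001CRAS_thm1_5 := by
  intro h
  have h1 := h 1 one_pos {((0 : ℂ), (0 : ℕ))} (fun _ => 1) (fun f _ G _ => by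
    simp [xPairing_zero_zero]) (0, 0) (Finset.mem_singleton_self _)
  exact one_ne_zero h1

/-- Under `IsXPairingFn G P` the compensated function vanishes at `v = −1`:
`P(−1) = gammaPlus(−1)·G(2) = 0`, Mathlib's `Γ(−1)` being `0` (a pole of `Γ` in print, cancelled by
the zero of `cos(πv/2)`: `γ₊(−1) = −2π²`). [folklore] -/
private theorem IsXPairingFn.apply_neg_one {G P : ℂ → ℂ} (hP : IsXPairingFn G P) : P (-1) = 0 := by
  have hne : ∀ n : ℕ, (-1 : ℂ) ≠ -(2 * (n : ℂ)) := by
    intro n h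
    have h' := congrArg Complex.re h
    simp only [Complex.neg_re, Complex.one_re, Complex.mul_re, Complex.re_ofNat, Complex.natCast_re,
      Complex.im_ofNat, Complex.natCast_im, mul_zero, sub_zero] at h'
    have h2 : (1 : ℝ) = 2 * (n : ℝ) := by linarith
    have h3 : (1 : ℤ) = 2 * (n : ℤ) := by exact_mod_cast h2
    omega
  have hΓ : Complex.Gamma (-1) = 0 := by exact_mod_cast Complex.Gamma_neg_nat_eq_zero 1
  rw [hP.2 (-1) hne, gammaPlus, hΓ]
  simp

/-- At `w = −1`, `k = 0` the `R`-pairing is the junk value `P(−1) = 0` for EVERY admissible `(G, P)`.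
[folklore] -/
private theorem xPairingR_neg_one_zero {G P : ℂ → ℂ} (hP : IsXPairingFn G P) :
    xPairingR G P (-1) 0 = 0 := by
  have h : ¬ (1 / 2 : ℝ) < (-1 : ℂ).re := by norm_num
  rw [xPairingR, if_neg h, iteratedDeriv_zero, hP.apply_neg_one]

/-- **`Burnol2001CRAS_thm1_5R` is FALSE as typed**: with `λ = 1`, the singleton family `{(−1, 0)}` and
`c ≡ 1`, the hypothesis holds for every `f`, `G`, `P` because `xPairingR G P (−1) 0 = P(−1) = 0` under
`IsXPairingFn G P` (Mathlib's `Γ(−1) = 0`), while `c (−1,0) = 1 ≠ 0`. This refutes the TYPING (the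
compensated product pinned at the odd negative integers, where `gammaPlus` carries junk zeros), not the
printed theorem, whose faithful form is `Burnol2001CRAS_thm1_5C`.
[cite: Burnol2001CRAS, Théorème 1.5 (TeX l.406–408)] -/
theorem Burnol2001CRAS_thm1_5R_false : ¬ Burnol2001CRAS_thm1_5R := by
  intro h
  have h1 := h 1 one_pos {((-1 : ℂ), (0 : ℕ))} (fun _ => 1) (fun f _ G P _ hP => by
    simp [xPairingR_neg_one_zero hP]) (-1, 0) (Finset.mem_singleton_self _)
  exact one_ne_zero h1

end Burnol2001

end Literature.Analysis.DeBrangesSpaces
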